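import Summits.AtomisticToContinuum.HydrodynamicLimit.Theorems.CollisionIsometryCLTMacroClosureTwoScaleDefs
import Summits.AtomisticToContinuum.HydrodynamicLimit.Theorems.CollisionIsometryCLTMacroClosureTwoScaleJensenPoint
import Summits.AtomisticToContinuum.HydrodynamicLimit.Theorems.AprioriBounds.Negative.AdmissibleKernel
import HarnessLib

/-!
# The two explicit kernel families of the two-scale statics are admissible (input of `stub_blockMGF_twoScale`,
line `IdeatorTwoGen1Sketch`, crux `MacroClosure`, stmt-AtomisticToContinuum-14870)

Proof file (`--supports stmt-AtomisticToContinuum-14870`) for the registered stub `Barycentric.stub_twoScale_admissible`.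

With `t_N := (N+1)^{1/15} ≥ 1` the mesh `mesh N = 64(⌊t_N⌋ + 1)` satisfies `64 t_N < mesh N ≤ 128 t_N`, whence the
side bounds `t_N⁻¹/128 ≤ side N ≤ t_N⁻¹/64`. The fine family `ρ_{side N/128}` is admissible exactly as in
`AprioriBoundsNegative.exists_admissibleKernelFamily` (sup `≤ ε⁻³ sup ρ₁`, gradient `≤ ε⁻⁴ sup ‖Dρ₁‖`,
support inside `{‖y‖ < ε}` and `euclidDist y 0 ≤ 4‖y‖`). The box family `b_ℓ ⋆ ρ_{ℓ/8}` (`ℓ = side N`) is smooth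
(`Torus.isSmooth_convolution`), nonnegative, has mass `(∫ b_ℓ)(∫ ρ) = 1` (`MeasureTheory.integral_convolution`; the
cube `{repr y ∈ [0,ℓ)³}` has volume `ℓ³` by `Torus.measurePreserving_repr`), is bounded with its gradient by
`sup ρ_{ℓ/8}`, `sup ‖∇ρ_{ℓ/8}‖` times `∫ |b_ℓ| = 1` (`Torus.norm_convolution_le`, `Torus.gradient_convolution`), and
vanishes once `euclidDist y 0 ≥ (N+1)^{-1/15}` because then no `w` in the cube has `‖y - w‖ < ℓ/8`. The
elementary box-kernel facts (`measurableSet_inCube`, `boxKernel_nonneg`) are those of the landed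
`CollisionIsometryCLTMacroClosureTwoScaleJensenPoint`.
-/

noncomputable section

open MeasureTheory Filter Set Topology InformationTheory
open scoped ENNReal ContDiff Convolution

namespace Summit.AtomisticToContinuum.HydrodynamicLimit.Theorems.MacroClosureLine

open Literature.MathematicalPhysics.KineticTheory Literature.Analysis.FluidPDE
open Literature.Analysis.FunctionSpaces

namespace Barycentric

namespace TwoScaleAdmissible

/-! ## The mesh and the side -/

/-- `t_N = (N+1)^{1/15} ≥ 1`. -/
theorem one_le_rpow_fifteenth (N : ℕ) : (1 : ℝ) ≤ ((N : ℝ) + 1) ^ (1 / 15 : ℝ) :=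
  Real.one_le_rpow (by simp) (by norm_num)

/-- The mesh as a real number. -/
theorem mesh_cast (N : ℕ) :
    ((mesh N : ℕ) : ℝ) = 64 * ((⌊((N : ℝ) + 1) ^ (1 / 15 : ℝ)⌋₊ : ℝ) + 1) := by
  unfold mesh
  push_cast
  ring

/-- `64 t_N < mesh N`. -/
theorem lt_mesh (N : ℕ) : 64 * ((N : ℝ) + 1) ^ (1 / 15 : ℝ) < (mesh N : ℝ) := by
  rw [mesh_cast]
  have := Nat.lt_floor_add_one (((N : ℝ) + 1) ^ (1 / 15 : ℝ))
  linarith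

/-- `mesh N ≤ 128 t_N`. -/
theorem mesh_le (N : ℕ) : (mesh N : ℝ) ≤ 128 * ((N : ℝ) + 1) ^ (1 / 15 : ℝ) := by
  rw [mesh_cast]
  have h0 := Nat.floor_le (Real.rpow_nonneg (by positivity : (0 : ℝ) ≤ (N : ℝ) + 1) (1 / 15 : ℝ))
  have h1 := one_le_rpow_fifteenth N
  linarith

/-- The side is positive. -/
theorem side_pos (N : ℕ) : 0 < side N := inv_pos.2 (Nat.cast_pos.2 (mesh_pos N))

/-- The side is at most `1/64`. -/
theorem side_le_inv (N : ℕ) : side N ≤ 1 / 64 := by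
  have h : (64 : ℝ) ≤ (mesh N : ℝ) := by
    rw [mesh_cast]
    have := Nat.cast_nonneg (α := ℝ) ⌊((N : ℝ) + 1) ^ (1 / 15 : ℝ)⌋₊
    nlinarith
  rw [side, one_div]
  exact inv_anti₀ (by norm_num) h

/-- `(N+1)^{-1/15} = t_N⁻¹`. -/
theorem rpow_neg_fifteenth (N : ℕ) :
    ((N : ℝ) + 1) ^ (-(1 / 15 : ℝ)) = (((N : ℝ) + 1) ^ (1 / 15 : ℝ))⁻¹ :=
  Real.rpow_neg (by positivity) _

/-- Upper side bound `side N ≤ (N+1)^{-1/15}/64`. -/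
theorem side_le (N : ℕ) : side N ≤ ((N : ℝ) + 1) ^ (-(1 / 15 : ℝ)) / 64 := by
  rw [rpow_neg_fifteenth]
  have ht : 0 < ((N : ℝ) + 1) ^ (1 / 15 : ℝ) := by positivity
  calc side N = ((mesh N : ℕ) : ℝ)⁻¹ := rfl
    _ ≤ (64 * ((N : ℝ) + 1) ^ (1 / 15 : ℝ))⁻¹ := inv_anti₀ (by positivity) (lt_mesh N).le
    _ = (((N : ℝ) + 1) ^ (1 / 15 : ℝ))⁻¹ / 64 := by ring

/-- Lower side bound `(N+1)^{-1/15}/128 ≤ side N`. -/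
theorem le_side (N : ℕ) : ((N : ℝ) + 1) ^ (-(1 / 15 : ℝ)) / 128 ≤ side N := by
  rw [rpow_neg_fifteenth]
  calc (((N : ℝ) + 1) ^ (1 / 15 : ℝ))⁻¹ / 128 = (128 * ((N : ℝ) + 1) ^ (1 / 15 : ℝ))⁻¹ := by ring
    _ ≤ ((mesh N : ℕ) : ℝ)⁻¹ := inv_anti₀ (Nat.cast_pos.2 (mesh_pos N)) (mesh_le N)
    _ = side N := rfl

/-- Inverse powers of `side N / c` against powers of `t_N`: `(c/side N)^k ≤ (128c)^4 t_N^k` (`k ≤ 4`, `1 ≤ c`). -/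
theorem inv_pow_side_div_le (N : ℕ) {k : ℕ} (hk : k ≤ 4) {c : ℝ} (hc : 1 ≤ c) :
    ((side N / c) ^ k)⁻¹ ≤ (128 * c) ^ 4 * (((N : ℝ) + 1) ^ (1 / 15 : ℝ)) ^ k := by
  have ht1 := one_le_rpow_fifteenth N
  rw [← inv_pow, side, inv_div, div_inv_eq_mul]
  calc (c * ((mesh N : ℕ) : ℝ)) ^ k ≤ (128 * c * ((N : ℝ) + 1) ^ (1 / 15 : ℝ)) ^ k :=
        pow_le_pow_left₀ (by positivity)
          ((mul_le_mul_of_nonneg_left (mesh_le N) (by positivity)).trans_eq (by ring)) k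
    _ = (128 * c) ^ k * (((N : ℝ) + 1) ^ (1 / 15 : ℝ)) ^ k := mul_pow _ _ _
    _ ≤ (128 * c) ^ 4 * (((N : ℝ) + 1) ^ (1 / 15 : ℝ)) ^ k :=
        mul_le_mul_of_nonneg_right (pow_le_pow_right₀ (by linarith) hk) (by positivity)

/-- `(N+1)^{3/15} = t_N^3`. -/
theorem rpow_three_fifteenth (N : ℕ) :
    ((N : ℝ) + 1) ^ (3 * (1 / 15) : ℝ) = (((N : ℝ) + 1) ^ (1 / 15 : ℝ)) ^ 3 := by
  rw [show (3 * (1 / 15) : ℝ) = (1 / 15) * ((3 : ℕ) : ℝ) by norm_num,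
    Real.rpow_mul_natCast (by positivity)]

/-- `(N+1)^{4/15} = t_N^4`. -/
theorem rpow_four_fifteenth (N : ℕ) :
    ((N : ℝ) + 1) ^ (4 * (1 / 15) : ℝ) = (((N : ℝ) + 1) ^ (1 / 15 : ℝ)) ^ 4 := by
  rw [show (4 * (1 / 15) : ℝ) = (1 / 15) * ((4 : ℕ) : ℝ) by norm_num,
    Real.rpow_mul_natCast (by positivity)]

/-! ## Sup bounds of the torus mollifier -/

/-- Uniform bounds `ρ_ε ≤ ε⁻³ K`, `‖∇ρ_ε‖ ≤ ε⁻⁴ K` of the torus mollifier on `𝕋³` (`0 < ε ≤ 1/4`). -/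
theorem exists_kernel_bounds : ∃ K : ℝ, 0 ≤ K ∧ ∀ ε : ℝ, 0 < ε → ε ≤ 1 / 4 →
    (∀ y : T3, Torus.kernel ε y ≤ (ε ^ 3)⁻¹ * K) ∧
    (∀ y : T3, ‖Torus.gradient (Torus.kernel ε) y‖ ≤ (ε ^ 4)⁻¹ * K) := by
  obtain ⟨K0, hK0⟩ := (Torus.contDiff_profileOne (d := Fin 3)).continuous.bounded_above_of_compact_support
    (Torus.hasCompactSupport_profileOne (d := Fin 3))
  obtain ⟨K1, hK1⟩ := (Torus.continuous_fderiv_profileOne (d := Fin 3)).bounded_above_of_compact_support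
    ((Torus.hasCompactSupport_profileOne (d := Fin 3)).fderiv (𝕜 := ℝ))
  have hK0' : K0 ≤ max (max K0 K1) 0 := (le_max_left _ _).trans (le_max_left _ _)
  have hK1' : K1 ≤ max (max K0 K1) 0 := (le_max_right _ _).trans (le_max_left _ _)
  refine ⟨max (max K0 K1) 0, le_max_right _ _, fun ε hε hε4 => ⟨fun y => ?_, fun y => ?_⟩⟩
  · unfold Torus.kernel
    rw [Torus.transplant_apply]
    simp only [Torus.profile, Fintype.card_fin]
    exact mul_le_mul_of_nonneg_left ((Real.le_norm_self _).trans ((hK0 _).trans hK0')) (by positivity)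
  · rw [Torus.norm_gradient_kernel hε hε4, Torus.fderiv_profile, norm_smul, Fintype.card_fin,
      Real.norm_eq_abs, abs_of_pos (mul_pos (inv_pos.2 (pow_pos hε 3)) (inv_pos.2 hε)), ← mul_inv,
      ← pow_succ]
    exact mul_le_mul_of_nonneg_left ((hK1 _).trans hK1') (by positivity)

/-! ## The box kernel -/

/-- The box kernel is integrable. -/
theorem integrable_boxKernel (ℓ : ℝ) : Integrable (boxKernel ℓ) :=
  (integrable_const (ℓ ^ 3)⁻¹).indicator (JensenPoint.measurableSet_inCube ℓ)

/-- The cube `{repr y ∈ [0, ℓ)³}` has volume `ℓ³` (`ℓ ≤ 1`). -/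
theorem volume_inCube {ℓ : ℝ} (hℓ1 : ℓ ≤ 1) : volume {y : T3 | inCube ℓ y} = ENNReal.ofReal ℓ ^ 3 := by
  have hB : MeasurableSet {v : EuclideanSpace ℝ (Fin 3) | ∀ l, v l < ℓ} := by
    have h : {v : EuclideanSpace ℝ (Fin 3) | ∀ l, v l < ℓ} = ⋂ l, (fun v => v l) ⁻¹' Iio ℓ := by
      ext v
      simp
    rw [h]
    exact MeasurableSet.iInter fun l => measurableSet_Iio.preimage (by fun_prop)
  rw [show {y : T3 | inCube ℓ y} = Torus.repr ⁻¹' {v | ∀ l, v l < ℓ} from rfl,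
    (Torus.measurePreserving_repr (d := Fin 3)).measure_preimage hB.nullMeasurableSet,
    Measure.restrict_apply hB]
  have h2 : {v : EuclideanSpace ℝ (Fin 3) | ∀ l, v l < ℓ} ∩ Torus.unitCube (Fin 3) =
      (WithLp.ofLp : EuclideanSpace ℝ (Fin 3) → (Fin 3 → ℝ)) ⁻¹' Set.univ.pi fun _ => Ico 0 ℓ := by
    ext v
    simp only [mem_inter_iff, mem_setOf_eq, Torus.mem_unitCube, mem_Ico, mem_preimage, mem_univ_pi]
    exact ⟨fun h i => ⟨(h.2 i).1, h.1 i⟩,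
      fun h => ⟨fun l => (h l).2, fun i => ⟨(h i).1, (h i).2.trans_le hℓ1⟩⟩⟩
  rw [h2, (PiLp.volume_preserving_ofLp (Fin 3)).measure_preimage
      (MeasurableSet.univ_pi fun _ => measurableSet_Ico).nullMeasurableSet, Real.volume_pi_Ico]
  simp

/-- The box kernel has unit mass (`0 < ℓ ≤ 1`). -/
theorem integral_boxKernel {ℓ : ℝ} (hℓ0 : 0 < ℓ) (hℓ1 : ℓ ≤ 1) : ∫ y, boxKernel ℓ y = 1 := by
  unfold boxKernel
  rw [integral_indicator_const _ (JensenPoint.measurableSet_inCube ℓ), measureReal_def, volume_inCube hℓ1,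
    ENNReal.toReal_pow, ENNReal.toReal_ofReal hℓ0.le, smul_eq_mul, mul_inv_cancel₀ (pow_pos hℓ0 3).ne']

/-- `∫ ‖b_ℓ‖ = 1` (`0 < ℓ ≤ 1`). -/
theorem integral_norm_boxKernel {ℓ : ℝ} (hℓ0 : 0 < ℓ) (hℓ1 : ℓ ≤ 1) : ∫ y, ‖boxKernel ℓ y‖ = 1 := by
  exact (integral_congr_ae (Eventually.of_forall fun y =>
    Real.norm_of_nonneg (JensenPoint.boxKernel_nonneg hℓ0 y))).trans (integral_boxKernel hℓ0 hℓ1)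

/-- A point of the cube `{repr w ∈ [0, ℓ)³}` has (sup quotient) norm at most `ℓ` (`0 ≤ ℓ ≤ 1/2`). -/
theorem norm_le_of_inCube {ℓ : ℝ} (hℓ0 : 0 ≤ ℓ) (hℓ : ℓ ≤ 1 / 2) {w : T3} (hw : inCube ℓ w) : ‖w‖ ≤ ℓ := by
  refine (pi_norm_le_iff_of_nonneg hℓ0).2 fun i => ?_
  have hi := Torus.repr_apply_mem_Ico w i
  have h1 : w i = ((Torus.repr w i : ℝ) : UnitAddCircle) := by
    have h := congrFun (Torus.proj_repr w) i
    rw [Torus.proj_apply] at h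
    exact h.symm
  have habs : |Torus.repr w i| ≤ ℓ := by
    rw [abs_of_nonneg hi.1]
    exact (hw i).le
  rw [h1, (AddCircle.norm_coe_eq_abs_iff (1 : ℝ) one_ne_zero).2 (by rw [abs_one]; linarith)]
  exact habs

/-! ## The two families -/

/-- The fine mollifier family `ρ_{side N/128}` is admissible with exponent `1/15`. -/
theorem admissible_fineFamily : ∃ C : ℝ, AdmissibleKernel (1 / 15) C fineFamily := by
  obtain ⟨K, hK0, hK⟩ := exists_kernel_bounds
  have hε0 : ∀ N, 0 < side N / 128 := fun N => div_pos (side_pos N) (by norm_num)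
  have hε4 : ∀ N, side N / 128 ≤ 1 / 4 := fun N => by have := side_le_inv N; linarith
  unfold AdmissibleKernel
  refine ⟨(128 * 128) ^ 4 * K, fun N => Torus.isSmooth_kernel (hε0 N) (hε4 N),
    fun N y => Torus.kernel_nonneg (hε0 N).le y, fun N => Torus.integral_kernel (hε0 N) (hε4 N),
    fun N y hy => ?_, fun N y => ?_, fun N y => ?_⟩
  · -- support
    refine Torus.kernel_eq_zero_of_le (hε0 N) ?_
    have h4 := AprioriBoundsNegative.euclidDist_zero_le_four_mul_norm y
    have hs := side_le N
    have hr : 0 < ((N : ℝ) + 1) ^ (-(1 / 15 : ℝ)) := by positivity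
    linarith
  · -- sup bound
    rw [rpow_three_fifteenth]
    calc fineFamily N y ≤ ((side N / 128) ^ 3)⁻¹ * K := (hK _ (hε0 N) (hε4 N)).1 y
      _ ≤ (128 * 128) ^ 4 * (((N : ℝ) + 1) ^ (1 / 15 : ℝ)) ^ 3 * K :=
          mul_le_mul_of_nonneg_right (inv_pow_side_div_le N (by norm_num) (by norm_num)) hK0
      _ = (128 * 128) ^ 4 * K * (((N : ℝ) + 1) ^ (1 / 15 : ℝ)) ^ 3 := by ring
  · -- gradient bound
    rw [rpow_four_fifteenth]
    calc ‖Torus.gradient (fineFamily N) y‖ ≤ ((side N / 128) ^ 4)⁻¹ * K := (hK _ (hε0 N) (hε4 N)).2 y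
      _ ≤ (128 * 128) ^ 4 * (((N : ℝ) + 1) ^ (1 / 15 : ℝ)) ^ 4 * K :=
          mul_le_mul_of_nonneg_right (inv_pow_side_div_le N le_rfl (by norm_num)) hK0
      _ = (128 * 128) ^ 4 * K * (((N : ℝ) + 1) ^ (1 / 15 : ℝ)) ^ 4 := by ring

/-- The box-smoothed family `b_{side N} ⋆ ρ_{side N/8}` is admissible with exponent `1/15`. -/
theorem admissible_boxFamily : ∃ C : ℝ, AdmissibleKernel (1 / 15) C boxFamily := by
  obtain ⟨K, hK0, hK⟩ := exists_kernel_bounds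
  have hε0 : ∀ N, 0 < side N / 8 := fun N => div_pos (side_pos N) (by norm_num)
  have hε4 : ∀ N, side N / 8 ≤ 1 / 4 := fun N => by have := side_le_inv N; linarith
  have hs1 : ∀ N, side N ≤ 1 := fun N => (side_le_inv N).trans (by norm_num)
  have hb : ∀ N, Integrable (boxKernel (side N)) := fun N => integrable_boxKernel _
  have hψ : ∀ N, Torus.IsSmooth (Torus.kernel (d := Fin 3) (side N / 8)) := fun N =>
    Torus.isSmooth_kernel (hε0 N) (hε4 N)
  have hb1 : ∀ N, ∫ w, ‖boxKernel (side N) w‖ = 1 := fun N =>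
    integral_norm_boxKernel (side_pos N) (hs1 N)
  unfold AdmissibleKernel
  refine ⟨(128 * 8) ^ 4 * K, fun N => Torus.isSmooth_convolution (hb N) (hψ N), fun N y => ?_,
    fun N => ?_, fun N y hy => ?_, fun N y => ?_, fun N y => ?_⟩
  · -- nonnegativity
    unfold boxFamily
    rw [convolution_lsmul]
    exact integral_nonneg fun w => smul_nonneg (JensenPoint.boxKernel_nonneg (side_pos N) w)
      (Torus.kernel_nonneg (hε0 N).le _)
  · -- unit mass
    unfold boxFamily
    rw [integral_convolution (ContinuousLinearMap.lsmul ℝ ℝ) (hb N) (hψ N).integrable,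
      integral_boxKernel (side_pos N) (hs1 N), Torus.integral_kernel (hε0 N) (hε4 N)]
    simp
  · -- support
    unfold boxFamily
    rw [convolution_lsmul]
    refine integral_eq_zero_of_ae (Eventually.of_forall fun w => ?_)
    show boxKernel (side N) w • Torus.kernel (side N / 8) (y - w) = 0
    by_cases hw : inCube (side N) w
    · rw [Torus.kernel_eq_zero_of_le (hε0 N) (not_lt.1 fun hlt => ?_), smul_zero]
      have hw' := norm_le_of_inCube (side_pos N).le ((side_le_inv N).trans (by norm_num)) hw
      have htri : ‖y‖ ≤ ‖y - w‖ + ‖w‖ := by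
        have := norm_add_le (y - w) w
        rwa [sub_add_cancel] at this
      have h4 := AprioriBoundsNegative.euclidDist_zero_le_four_mul_norm y
      have hs := side_le N
      have hr : 0 < ((N : ℝ) + 1) ^ (-(1 / 15 : ℝ)) := by positivity
      linarith
    · simp [boxKernel, hw]
  · -- sup bound
    rw [rpow_three_fifteenth]
    calc boxFamily N y ≤ ‖(boxKernel (side N) ⋆ Torus.kernel (side N / 8)) y‖ := Real.le_norm_self _
      _ ≤ ((side N / 8) ^ 3)⁻¹ * K * ∫ w, ‖boxKernel (side N) w‖ :=
          Torus.norm_convolution_le (hb N) (fun x => by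
            rw [Real.norm_of_nonneg (Torus.kernel_nonneg (hε0 N).le x)]
            exact (hK _ (hε0 N) (hε4 N)).1 x) y
      _ = ((side N / 8) ^ 3)⁻¹ * K := by rw [hb1, mul_one]
      _ ≤ (128 * 8) ^ 4 * (((N : ℝ) + 1) ^ (1 / 15 : ℝ)) ^ 3 * K :=
          mul_le_mul_of_nonneg_right (inv_pow_side_div_le N (by norm_num) (by norm_num)) hK0
      _ = (128 * 8) ^ 4 * K * (((N : ℝ) + 1) ^ (1 / 15 : ℝ)) ^ 3 := by ring
  · -- gradient bound
    rw [rpow_four_fifteenth]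
    unfold boxFamily
    rw [Torus.gradient_convolution (hb N) (hψ N)]
    calc ‖(boxKernel (side N) ⋆ Torus.gradient (Torus.kernel (side N / 8))) y‖
          ≤ ((side N / 8) ^ 4)⁻¹ * K * ∫ w, ‖boxKernel (side N) w‖ :=
          Torus.norm_convolution_le (hb N) (hK _ (hε0 N) (hε4 N)).2 y
      _ = ((side N / 8) ^ 4)⁻¹ * K := by rw [hb1, mul_one]
      _ ≤ (128 * 8) ^ 4 * (((N : ℝ) + 1) ^ (1 / 15 : ℝ)) ^ 4 * K :=
          mul_le_mul_of_nonneg_right (inv_pow_side_div_le N le_rfl (by norm_num)) hK0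
      _ = (128 * 8) ^ 4 * K * (((N : ℝ) + 1) ^ (1 / 15 : ℝ)) ^ 4 := by ring

end TwoScaleAdmissible

open TwoScaleAdmissible in
/-- **The box-smoothed family and the fine mollifier family are admissible** with exponent `1/15`, and the box side `ℓ_N = side N` is comparable with `(N+1)^{-1/15}` (registered stub `stub_twoScale_admissible`). [folklore] -/
theorem stub_twoScale_admissible : (∃ C C₂ : ℝ, AdmissibleKernel (1 / 15) C boxFamily ∧
    AdmissibleKernel (1 / 15) C₂ fineFamily) ∧
    (∀ N : ℕ, side N ≤ ((N : ℝ) + 1) ^ (-(1 / 15 : ℝ)) / 64) ∧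
    (∀ N : ℕ, ((N : ℝ) + 1) ^ (-(1 / 15 : ℝ)) / 128 ≤ side N) := by
  obtain ⟨C, hC⟩ := admissible_boxFamily
  obtain ⟨C₂, hC₂⟩ := admissible_fineFamily
  exact ⟨⟨C, C₂, hC, hC₂⟩, side_le, le_side⟩

end Barycentric

end Summit.AtomisticToContinuum.HydrodynamicLimit.Theorems.MacroClosureLine

end
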